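import Summits.QuantumFields.YangMills.Theorems.BalabanUVNodesN07RecordDomainsAdm22
import Summits.QuantumFields.YangMills.Theorems.BalabanUVNodesN07CubeDomainsAdm22
import Literature.MathematicalPhysics.QuantumFieldTheory.Balaban1983to89.Node00.TorusCoverCollarOfMeetsPrintBox
import HarnessLib

/-!
# N07 [B11] (= [15] = [Balaban1985Variational]) Sect. F, road of record R0′, S6 HEAD — **THE OUTWARD MEET EDITION, FILE D0: PRINT's (150) FAMILY AT THE RECORD** — the admissibility
# `Adm22 D″ R (L·M_h)` of `D″ = cubeDomains ⊓ domainsOfSeq s.Ω (K−n)` and the window's collar «π(□) ⊆ Ω_{K−n−1}» FROM THE TOKEN's DATA: the record `s` (cube classes `unionsOfCubes`),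
# its separation `Sect2.SeqSeparated ν.M₁ s` at the RUN's big block `ν.M₁`, the V20-G floor `R·L·M_h ≤ ρ`, `(44 + 4ρ + Mc + 3)·L ≤ c ≤ ν.M₁`, and the run's grid numerics
# `hgran : L·M_h ∣ M·R_j`, `hdiv : dCubeSide L M R_j j ∣ sitesPerDir 0` (n07-e `OUTWARD-MEET-EDITION-SPEC.md` §3∕§6; plan g86 I.40244: through the GUARD only)

Cell `pub-ymgap`, width seat `pub-ymgap-dag-n07-w4` g5 (sub-target S6 = the HEAD; MODULE 57 default pen), INTENT-5 (cell bus).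
`--kind proof --supports stmt-QuantumFields-27364 --as helper` (K1⁹ per dag-lead KEY MAP v2); count-neutral; def-free.
[15] = [Balaban1985Variational]; [B6-II] = [Balaban1984PropagatorsII]; [6] = [Balaban1985RegularSpaces]; [III] = [Balaban1988Convergent].

THE POINT (LOCATED while typing (E4)).  n07-w6's `adm22_domainsOfSeq_of_fineSat_of_sep` couples the LABEL block of (2.1) and the SEPARATION block of (2.2): `Adm22 · R M₁` from
`SeqSeparated M₁ s` needs `R·M₁ + 1 ≤ L·M₁`, i.e. `R ≤ L − 1` — not available for the H-block `M₁ = L·M_h` (the S5 doors' `R ≥ R₀(F)` is free).  But the record is separated at the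
RUN's block `ν.M₁ ≫ L·M_h` (one layer of `L^{j+1}ν.M₁`-cubes), and (2.2) only needs `R·(L·M_h) + 1 ≤ L·ν.M₁` — the V20-G floor (`R·L·M_h ≤ ρ`, `ρ + 1 ≤ c ≤ ν.M₁`).  §1 decouples
the two blocks (n07-w6's proof verbatim with `side L M_s (j+1)` in the one separation step); so NO 57b descent and NO `R ≤ L − 1`.

WHAT IS PROVED (sorry-free; no definition; axioms standard).
§1 ★★ `adm22_domainsOfSeq_of_fineSat_of_sep₂` — `Adm22 (domainsOfSeq Ω k hk) R M₁` from `M₁`-label saturation of the `Ω_j` and ONE layer of `L^{j+1}M_s`-cubes around `Ω_{j+1}` inside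
   `Ω_j`, for ANY separation block `M_s` with `R·M₁ + 1 ≤ L·M_s` (n07-w6's lemma is `M_s = M₁`).
§2 ★★ `adm22_domainsOfSeq_trunc_seqOfRecord (F)` — at the record `s : SeqOfRecord F ν M g K k`, every truncation height `k′ ≤ k`: `Adm22 (domainsOfSeq s.Ω k′ hk′) R M₁` from
   `SeqSeparated M_s s`, `R·M₁ + 1 ≤ L·M_s`, and the grid numerics `hdiv`, `hgran : M₁ ∣ M·R_j` (`1 ≤ j ≤ k′`).
§3 ★★★ `adm22_meetCube_trunc_seqOfRecord (F)` — `Adm22 (domainsMeet (cubeDomains (F.P K) a M′ ρ k′ hk′) (domainsOfSeq s.Ω k′ hk′)) R (L·M_h)` from 39b `adm22_cubeDomains` (print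
   datum numerics `L·M_h ∣ ρ, a_i, M′, sitesPerDir k′`, `R·L·M_h ≤ ρ`) and §2 at `M₁ := L·M_h`, `M_s := ν.M₁`.
§4 ★ `cover_mem_Ω_pred_of_meet_box (F)` — the window's collar: at a level `2 ≤ n ≤ k` datum whose print box has a point within `3` of a lift of a site of `Ω_n` (the token's
   meeting premise, box form), EVERY point of the box projects into `Ω_{n−1}` — n07-e 57a `Sect2.cover_mem_Ω_pred_of_near_box_propCubeP_box` at `E = 0`, floor `11d + 2ρ + Mc + 3 ≤ ν.M₁`.
HONEST SCOPE.  Lattice ∕ torus-cube bookkeeping by name; the grid numerics `hgran`∕`hdiv`, the floors and the separation are HYPOTHESES (the knit reads them off its guard); nothing of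
[15]∕[B6-II]∕[6]∕[III] analysis asserted; no token ∕ stub ∕ K-item closed; N07 NOT discharged; counts unmoved (typed 28∕28 · discharged 5∕27); one finite 𝕋⁴ programme at fixed ε —
the route closes the conditional finite-𝕋⁴ rung `BalabanLadder.UV` ONLY; the YM mass gap (Clay) is NOT proved by any of this; nothing continuum ∕ ℝ⁴ ∕ OS.  No `sorry` ∕ `def` ∕
`instance` ∕ `notation`.

RELATED IN THE TREE, NOT DUPLICATED: n07-w6 `N07RecordDomainsAdm22` (§1's one-block parent, `adm22_meet`, `fineSat_of_unionsOfCubes_seq`, `pow_mul_dvd_dCubeSide`, `blockSat_seqOfRecord`);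
39b `N07CubeDomainsAdm22.adm22_cubeDomains`; n07-e 57a `TorusCoverCollarOfMeetsPrintBox`.

References: [B6-II] (2.1)–(2.3) p. 224; [6] (1.3)–(1.6) p. 77, p. 98, (1.131) p. 99; [III] (2.1) p. 254, p. 256; [15] (144) p. 300, (150) p. 301.
-/

set_option autoImplicit false

noncomputable section

namespace Summit.QuantumFields.YangMills.BalabanUVNodes.N07MeetFamilyAtRecord

open Literature.MathematicalPhysics.QuantumFieldTheory.Balaban1983to89
open Literature.MathematicalPhysics.QuantumFieldTheory.Balaban1983to89.Node00
open B6SectADomainsV1 (Domains)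
open B5Eq118OneStroke (iterBlockOf iterBlockOf_succ val_iterBlockOf)
open B5Prop12FieldsLattice (distSite)
open B15DeterminingSets (embIter)
open B15Eq112TorusCover (cover)
open B14DomainGeom (Pt Within)
open B14.Eq213MaximalDomains (side side_pos)
open B8Eq131Cubes (box)
open T4Continuum (T4Family)
open Summit.QuantumFields.YangMills.Theorems.FlatCubeOpsText (Adm22)
open Summit.QuantumFields.YangMills.Theorems.IterPlaqSmallAllL (distSite_zero_le_pow)
open Summit.QuantumFields.YangMills.BalabanUVNodes.N07RecordDomainsAdm22 (adm22_meet le_distSite_of_not_mem_enlT fineSat_of_unionsOfCubes_seq pow_mul_dvd_dCubeSide)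
open Summit.QuantumFields.YangMills.BalabanUVNodes.N07CubeDomainsAdm22 (adm22_cubeDomains)

variable {P : Params}

/-! ## §1  `Adm22 (domainsOfSeq Ω k)` with the label block and the separation block DECOUPLED -/

/-- ★★ **(2.1)–(2.2) FOR THE V1 FAMILY OF A SEPARATED SEQUENCE, TWO BLOCKS**: let the regions `Ω_j` (`1 ≤ j ≤ k`) be nested and saturated for the `LʲM₁`-labels, and let one layer of
`L^{j+1}M_s`-cubes around `Ω_{j+1}` stay inside `Ω_j` (`Sect2.enlT P (side L M_s (j+1)) 1 (Ω (j+1)) ⊆ Ω j`) for a possibly DIFFERENT block `M_s` with `R·M₁ + 1 ≤ L·M_s`.  Then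
`domainsOfSeq Ω k hk` is (2.1)–(2.2)-admissible with big blocks `M₁` and separation `R·M₁` (n07-w6's `adm22_domainsOfSeq_of_fineSat_of_sep` is `M_s = M₁`; proof verbatim otherwise).
[cite: Balaban1984PropagatorsII, (2.1)-(2.2) p.224; Balaban1985RegularSpaces, (1.3)-(1.6) p.77; Balaban1988Convergent, (2.1) p.254, p.256] -/
theorem adm22_domainsOfSeq_of_fineSat_of_sep₂ {Ω : ℕ → Set (Site P 0)} {k : ℕ} (hk : k ≤ P.m + P.K) {R M₁ Ms : ℕ} (hMs : 1 ≤ Ms)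
    (hR : R * M₁ + 1 ≤ P.L * Ms)
    (hnest : ∀ i : ℕ, 1 ≤ i → i < k → Ω (i + 1) ⊆ Ω i)
    (hsat : ∀ j : ℕ, 1 ≤ j → j ≤ k → ∀ x x' : Site P 0, (∀ μ, (x μ).val / (P.L ^ j * M₁) = (x' μ).val / (P.L ^ j * M₁)) → x ∈ Ω j → x' ∈ Ω j)
    (hsep : ∀ j : ℕ, 1 ≤ j → j < k → Sect2.enlT P (side P.L Ms (j + 1)) 1 (Ω (j + 1)) ⊆ Ω j) :
    Adm22 (domainsOfSeq Ω k hk) R M₁ := by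
  unfold Adm22
  refine ⟨fun j hj1 y y' hlab => ?_, fun j y y' hy hy' => ?_⟩
  · -- (2.1)
    by_cases hjk : j ≤ k
    · have hjK : j ≤ P.m + P.K := hjk.trans hk
      have key : ∀ y y' : Site P j, (∀ μ, (y μ).val / M₁ = (y' μ).val / M₁) →
          y ∈ (domainsOfSeq Ω k hk).Om j → y' ∈ (domainsOfSeq Ω k hk).Om j := by
        intro y y' hlab hy
        rw [mem_domainsOfSeq_Om_iff_subset Ω hk hnest hj1 hjk] at hy ⊢
        intro x' hx'
        have hx : embIter j y ∈ Ω j := hy _ (iterBlockOf_embIter_eq hjK y)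
        refine hsat j hj1 hjk (embIter j y) x' (fun μ => ?_) hx
        rw [← Nat.div_div_eq_div_mul, ← Nat.div_div_eq_div_mul, ← val_iterBlockOf j hjK (embIter j y) μ, ← val_iterBlockOf j hjK x' μ,
          iterBlockOf_embIter_eq hjK y, hx', hlab μ]
      exact ⟨key y y' hlab, key y' y fun μ => (hlab μ).symm⟩
    · rw [domainsOfSeq_Om_of_gt Ω hk (not_le.mp hjk)]
      simp
  · -- (2.2): the level is below `k`
    have hjk : j + 1 ≤ k := by
      by_contra h
      rw [domainsOfSeq_Om_of_gt Ω hk (by omega)] at hy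
      exact absurd hy (Finset.notMem_empty _)
    have hjK : j ≤ P.m + P.K := by omega
    rcases Nat.eq_zero_or_pos j with rfl | hj1
    · exact (hy' (by rw [(domainsOfSeq Ω k hk).Om_zero]; exact Finset.mem_univ _)).elim
    -- the centre of `y` lies in `Ω_{j+1}`
    have hx : embIter j y ∈ Ω (j + 1) := by
      rw [mem_domainsOfSeq_Om_iff Ω hk hjk] at hy
      refine hy (embIter j y) ?_ (j + 1) (by omega) le_rfl
      rw [iterBlockOf_succ, iterBlockOf_embIter_eq hjK y]
    -- some fine point of `Bʲ(y′)` lies outside `Ω_j`, hence outside `(Ω_{j+1})^{∼1}` for the `M_s`-cubes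
    rw [mem_domainsOfSeq_Om_iff_subset Ω hk hnest hj1 (by omega)] at hy'
    push Not at hy'
    obtain ⟨x', hx'y, hx'⟩ := hy'
    have hx'e : x' ∉ Sect2.enlT P (side P.L Ms (j + 1)) 1 (Ω (j + 1)) := fun h => hx' (hsep j hj1 (by omega) h)
    have hside : 0 < side P.L Ms (j + 1) := side_pos P.L_pos hMs (j + 1)
    have hfar := le_distSite_of_not_mem_enlT hside hx hx'e
    -- compare with the block distance
    have hcmp := distSite_zero_le_pow j hjK (embIter j y) x'
    rw [iterBlockOf_embIter_eq hjK y, hx'y] at hcmp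
    have hsideR : ((side P.L Ms (j + 1) : ℕ) : ℝ) = (P.L : ℝ) ^ j * ((P.L : ℝ) * Ms) := by
      simp only [side, Nat.cast_mul, Nat.cast_pow, pow_succ]; ring
    rw [hsideR] at hfar
    have hRr : ((R * M₁ : ℕ) : ℝ) + 1 ≤ (P.L : ℝ) * Ms := by exact_mod_cast hR
    have hLj : (1 : ℝ) ≤ (P.L : ℝ) ^ j := one_le_pow₀ (by exact_mod_cast P.L_pos)
    by_contra hle
    rw [not_lt] at hle
    have h1 := mul_le_mul_of_nonneg_left hle (zero_le_one.trans hLj)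
    have h2 := mul_le_mul_of_nonneg_left hRr (zero_le_one.trans hLj)
    nlinarith [h1, h2, hfar, hcmp, hLj]

/-! ## §2  At the record, truncated at any height `k′ ≤ k` -/

variable (F : T4Family)

/-- ★★ **THE RECORD's REGION FAMILY TRUNCATED AT `k′ ≤ k` IS ADMISSIBLE, LABELS AT `M₁`, SEPARATION AT `M_s`**: for `s : SeqOfRecord F ν M g K k`, `Sect2.SeqSeparated M_s s`
(`1 ≤ M_s`, `R·M₁ + 1 ≤ L·M_s`), and the grid numerics `dCubeSide L M R_j j ∣ sitesPerDir 0`, `M₁ ∣ M·R_j` (`1 ≤ j ≤ k′`): `Adm22 (domainsOfSeq s.Ω k′ hk′) R M₁`.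
[cite: Balaban1984PropagatorsII, (2.1)-(2.2) p.224; Balaban1988Convergent, (2.1) p.254, p.256; Balaban1985RegularSpaces, (1.3)-(1.6) p.77] -/
theorem adm22_domainsOfSeq_trunc_seqOfRecord (ν : Stage7Numerics) (M : ℕ) (g : ℕ → ℝ) (K k : ℕ) (s : SeqOfRecord F ν M g K k)
    {k' : ℕ} (hk'k : k' ≤ k) (hk' : k' ≤ (F.P K).m + (F.P K).K) {R M₁ Ms : ℕ} (hMs : 1 ≤ Ms) (hR : R * M₁ + 1 ≤ (F.P K).L * Ms) (hsep : Sect2.SeqSeparated Ms s)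
    (hdiv : ∀ j : ℕ, 1 ≤ j → j ≤ k' → dCubeSide (F.P K).L M (RkOfRecord (F.P K).L ν.r (g j)) j ∣ (F.P K).sitesPerDir 0)
    (hgran : ∀ j : ℕ, 1 ≤ j → j ≤ k' → M₁ ∣ M * RkOfRecord (F.P K).L ν.r (g j)) :
    Adm22 (domainsOfSeq s.Ω k' hk') R M₁ :=
  adm22_domainsOfSeq_of_fineSat_of_sep₂ hk' hMs hR (fun _ h1 hi => s.chain.Ω_succ_subset_Ω h1 (lt_of_lt_of_le hi hk'k))
    (fineSat_of_unionsOfCubes_seq (c := fun j => dCubeSide (F.P K).L M (RkOfRecord (F.P K).L ν.r (g j)) j) (fun j h1 hj => s.chain.memΩ j h1 (hj.trans hk'k)) hdiv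
      (fun j h1 hj => pow_mul_dvd_dCubeSide j (hgran j h1 hj)))
    (fun j h1 hj => hsep j h1 (lt_of_lt_of_le hj hk'k))

/-! ## §3  Print's (150) family at the record: the meet of the print datum's tower with the truncated record family -/

/-- ★★★ **`Adm22 D″ R (L·M_h)` AT THE RECORD** for `D″ := domainsMeet (cubeDomains (F.P K) a M′ ρ k′ hk′) (domainsOfSeq s.Ω k′ hk′)` — print's «Ω′_j = □_j (j < k′), Ω′_{k′} = □_{k′} ∩ Ω_{k′}»:
the cube side from the print datum's numerics (`L·M_h ∣ ρ, a_i, M′, sitesPerDir k′`, `R·L·M_h ≤ ρ`; 39b), the record side from §2 with labels at `L·M_h` and separation at the run's block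
`ν.M₁` (`R·L·M_h + 1 ≤ L·ν.M₁` — the V20-G floor), grid numerics `hdiv`, `hgran : L·M_h ∣ M·R_j` (`1 ≤ j ≤ k′`).
[cite: Balaban1985Variational, (144) p.300, (150) p.301; Balaban1984PropagatorsII, (2.1)-(2.2) p.224; Balaban1985RegularSpaces, p.98, (1.131) p.99] -/
theorem adm22_meetCube_trunc_seqOfRecord (ν : Stage7Numerics) (M : ℕ) (g : ℕ → ℝ) (K k : ℕ) (s : SeqOfRecord F ν M g K k)
    {k' : ℕ} (hk'k : k' ≤ k) (hk' : k' ≤ (F.P K).m + (F.P K).K) {R Mh : ℕ} (hM₁ : 1 ≤ F.L * Mh) (hν : 1 ≤ ν.M₁)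
    (hR : R * (F.L * Mh) + 1 ≤ (F.P K).L * ν.M₁) (hsep : Sect2.SeqSeparated ν.M₁ s)
    (hdiv : ∀ j : ℕ, 1 ≤ j → j ≤ k' → dCubeSide (F.P K).L M (RkOfRecord (F.P K).L ν.r (g j)) j ∣ (F.P K).sitesPerDir 0)
    (hgran : ∀ j : ℕ, 1 ≤ j → j ≤ k' → F.L * Mh ∣ M * RkOfRecord (F.P K).L ν.r (g j))
    {a : Pt (F.P K).d} {M' ρ : ℕ} (hρ : F.L * Mh ∣ ρ) (ha : ∀ i, ((F.L * Mh : ℕ) : ℤ) ∣ a i) (hM' : F.L * Mh ∣ M') (hper : F.L * Mh ∣ (F.P K).sitesPerDir k')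
    (hRρ : R * (F.L * Mh) ≤ ρ) :
    Adm22 (domainsMeet (cubeDomains (F.P K) a M' ρ k' hk') (domainsOfSeq s.Ω k' hk')) R (F.L * Mh) :=
  adm22_meet (adm22_cubeDomains (P := F.P K) hM₁ hρ ha hM' hper hRρ) (adm22_domainsOfSeq_trunc_seqOfRecord F ν M g K k s hk'k hk' hν hR hsep hdiv hgran)

/-! ## §4  The window's collar at a meeting datum: «π(□) ⊆ Ω_{n−1}» -/

/-- ★ **EVERY POINT OF THE PRINT BOX OF A MEETING DATUM PROJECTS INTO `Ω_{n−1}`** (`2 ≤ n ≤ k`; the HEAD's collar (144) «□̃ ⊂ Ω_{n−1}» read on the box itself): if the box has a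
point within `3` of a lift of a site of `Ω_n` (the token's meeting premise in n07-e's box form) and `11d + 2ρ + Mc + 3 ≤ ν.M₁`, then `cover z ∈ s.Ω (n−1)` for every `z` in the box —
57a `Sect2.cover_mem_Ω_pred_of_near_box_propCubeP_box` at `E = 0`. [cite: Balaban1985Variational, (144) p.300, (150) p.301; Balaban1985RegularSpaces, p.98, (1.3)–(1.6) p.77] -/
theorem cover_mem_Ω_pred_of_meet_box (ν : Stage7Numerics) (M : ℕ) (g : ℕ → ℝ) (K k : ℕ) (s : SeqOfRecord F ν M g K k) (hν : 1 ≤ ν.M₁)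
    (hsep : Sect2.SeqSeparated ν.M₁ s) {ρ Mc : ℕ} (hfloor : 11 * (F.P K).d + 2 * ρ + Mc + 3 ≤ ν.M₁) {n : ℕ} (hn : 2 ≤ n) (hnk : n ≤ k) {a : Pt (F.P K).d}
    (hmeet : ∃ x ∈ box (F.P K).L (cornerP (F.P K) Mc ρ a) (sideP (F.P K) Mc ρ) n, ∃ y : Pt (F.P K).d, cover (F.P K) y ∈ s.Ω n ∧ Within ((3 : ℕ) : ℤ) x y) :
    ∀ z ∈ box (F.P K).L (cornerP (F.P K) Mc ρ a) (sideP (F.P K) Mc ρ) n, cover (F.P K) z ∈ s.Ω (n - 1) := by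
  intro z hz
  obtain ⟨x, hx, y, hy, hxy⟩ := hmeet
  have hfl : 11 * (F.P K).d + 2 * ρ + Mc + 3 + 0 ≤ ν.M₁ := by simpa using hfloor
  refine Sect2.cover_mem_Ω_pred_of_near_box_propCubeP_box (P := F.P K) hν s hsep (Dw := 3) (E := 0) hfl hn hnk hx hy hxy hz ?_
  exact Within.refl (by positivity) z

end Summit.QuantumFields.YangMills.BalabanUVNodes.N07MeetFamilyAtRecord

end
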